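import Literature.NumberTheory.EllipticCurves.Rank1Residual.X9CMPartner
import Literature.NumberTheory.EllipticCurves.CyclotomicIwasawaMainTheoremIrreducible
import Literature.NumberTheory.EllipticCurves.ModPReducibilityProofs
import Literature.NumberTheory.EllipticCurves.ModularCurvePeriodRatio
import Literature.NumberTheory.EllipticCurves.LeadingTermPPartEisensteinProofs
import HarnessLib

/-!
# BSD rank-≤1 residual cell — class X9: the residue is EXACTLY Greenberg's `μ`-conjecture, pair by
# pair, after one finite analytic certificate (and, in rank 1, the Schneider certificate)

HONEST FRAMING (cell `b2b-bsdres-*`, verbatim): the goal of the cell is to DELETE the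
COMBINATION-SHAPED residual classes for ALL analytic-rank ≤ 1 curves over ℚ — "full BSD formula
for every rank ≤ 1 curve in class C" assembled STRICTLY from published theorems — so that the
rank-≤1 remainder becomes exactly the CONSTRUCTION-SHAPED classes, which are TYPED (missing-input
Props), NOT attempted; this is not "finishing BSD".

Theorems only (no definitions, no named facts; X9 prover gen 5). On class X9 (`Rank1Residual.ClassX9`:
non-CM, good ordinary `p ≥ 5`, `E[p]` irreducible, `ρ̄_{E,p}` not surjective) the published state of
Mazur's main conjecture is Burungale–Castella–Skinner 2025 Thm. 1.1.2 (a): `X(E/ℚ_∞)` is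
`Λ`-torsion and `char_Λ X = (p^k · L_p(E))` for some `k ∈ ℤ` (tree fact
`burungale_castella_skinner_charIdeal_eq_padicLFunction`); part (b) (`k = 0`) needs (im), false on
X9 (`X9SmallImage`), and `k = μ(X) − μ(L_p)` is the whole defect of the `p`-part (gen 1,
`Rank1ResidualX9Defs`). This file makes that prose a KERNEL statement and sharpens it:

1. `exponent_eq_zero_of_hasUnitContent` — for `g ∈ Λ`, `L ∈ ℚ_p⟦T⟧` INTEGRAL with one unit
   coefficient and `ι g = p^k · L`: `μ(g) = 0 ⇒ k = 0` (and conversely `k = 0 ⇒ μ(g) = 0`,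
   `hasUnitContent_of_exponent_eq_zero`). Integrality of `L_p(E)` at an irreducible good ordinary
   prime is the tree THEOREM `padicLFunction_mem_integral_holds` (Greenberg–Vatsal 2000 Prop. 3.7),
   so `μ(L_p(E)) ≥ 0` is free and the analytic certificate "one coefficient of `𝓛_MSD(E)` is a
   `p`-adic unit" (finite, exact modular symbols; the same shape as gen 4's C2) says `μ(L_p(E)) = 0`.
2. `mazurMainConjecture_of_mu_eq_zero` — hence at a good ordinary irreducible `p ≥ 5`:
   `μ(X(E/ℚ_∞)) = 0` (Greenberg, LNM 1716 Conj. 1.11 for `(E, p)`: OPEN, taken as an explicit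
   per-pair binder `hμ`, never asserted) + the certificate ⟹ the INTEGRAL main conjecture
   `char_Λ X = (L_p(f, α))` — the conclusion of BCS Thm. 1.1.2 (b) without (im).
3. `X9.bsdp_of_mu_eq_zero` (rank 0, Greenberg's Thm. 4.1 glue), `…_of_analyticRank_eq_one` (rank 1,
   + Schneider C3, Perrin-Riou–Schneider engine), `…_of_analyticRank_le_one`,
   `X9.missingInputAt_of_mu_eq_zero`.
4. CONVERSELY, `X9.mu_eq_zero_of_bsdp` (rank 0): `BSD(E,p)` + the certificate ⟹ `μ(X(E/ℚ_∞)) = 0`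
   for every cyclotomic dual datum — via the valuation chain of Castella–Grossi–Lee–Skinner's proof
   of Thm. 5.1.4 run with the exponent `k` (`padicValRat_lvalue_of_charIdeal_eq_zpow`), which shows
   `BSD(E,p) ⟺ k = 0`. So `X9.bsdp_iff_mu_eq_zero`: **on X9 in analytic rank 0, granted the finite
   certificate, the `p`-part of BSD is EQUIVALENT to Greenberg's `μ = 0` conjecture for `(E, p)`** —
   the typed residue of X9 is not merely implied by but IS that conjecture instance; no "integral
   input" weaker than `μ^alg = 0` can exist. (Example for the reader, not a tree statement: for the
   census pair `2268b1 @ 5` — `a_5 = -2`, `∏ c_ℓ = 1`, `#Ш_an = 1`, so `𝓛_5(E)(0)` is a unit — BSD is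
   known by Creutz–Miller, hence `μ = λ = 0` for this `𝔖₄`-image curve.)

Inputs (PUBLISHED named facts, as binders): BCS 2025 Thm. 1.1.2 (a) (`hBCS`), Greenberg LNM 1716
Thm. 4.1 (`hGr`), the period unit `Ω_E = u·Ω⁺_f` (`h5`, Greenberg–Vatsal §3 / Abbes–Ullmo),
modularity (`hmodP`, `hmodL`), GZK (`hGZK`); rank 1: Perrin-Riou–Schneider (`hS`), Perrin-Riou 1987
(`hPR`). OPEN per-pair binder: `hμ`. Finite certificate: `hcert`. The class label (CONSTRUCTION-SHAPED)
is unchanged; nothing is closed by this file.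
-/

set_option autoImplicit false

noncomputable section

open scoped Classical MatrixGroups ModularForm

open CongruenceSubgroup WeierstrassCurve Literature.NumberTheory.EllipticCurves
  Literature.NumberTheory.EllipticCurves.ModularForms

namespace Literature.NumberTheory.EllipticCurves.Rank1Residual

/-! ### The exponent lemma: `ι g = p^k · L`, `L` integral with a unit coefficient -/

/-- **`μ(g) = 0` forces the exponent to vanish.** For `g ∈ Λ = ℤ_p⟦T⟧`, `L ∈ ℚ_p⟦T⟧` with all
coefficients of norm `≤ 1` (`hint`) and one of norm `1` (`hunit`), and `ι g = p^k · L` (`h`): if `g`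
has unit content (`μ(g) = 0`) then `k = 0`. Proof: the unit coefficient of `L` gives
`p^{-k} = ‖g_n‖ ≤ 1`, i.e. `k ≥ 0`; a unit coefficient of `g` gives `1 = p^{-k}‖L_m‖ ≤ p^{-k}`, i.e.
`k ≤ 0`. [folklore] -/
theorem exponent_eq_zero_of_hasUnitContent {p : ℕ} [Fact p.Prime] (g : IwasawaAlgebra p)
    (L : PowerSeries ℚ_[p]) (k : ℤ)
    (h : iwasawaToPowerSeries p g = PowerSeries.C ((p : ℚ_[p]) ^ k) * L)
    (hint : ∀ n : ℕ, ‖PowerSeries.coeff n L‖ ≤ 1) (hunit : ∃ n : ℕ, ‖PowerSeries.coeff n L‖ = 1)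
    (hg : GreenbergVatsal2000.HasUnitContent g) : k = 0 := by
  have hpP : p.Prime := Fact.out
  have hp1 : (1 : ℝ) < p := by exact_mod_cast hpP.one_lt
  have hcoeff : ∀ n : ℕ, ‖((PowerSeries.coeff n g : ℤ_[p]) : ℚ_[p])‖ =
      (p : ℝ) ^ (-k) * ‖PowerSeries.coeff n L‖ := by
    intro n
    have hn := congrArg (PowerSeries.coeff n) h
    rw [iwasawaToPowerSeries, PowerSeries.coeff_map, PowerSeries.coeff_C_mul] at hn
    change ((PowerSeries.coeff n g : ℤ_[p]) : ℚ_[p]) = _ at hn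
    rw [hn, norm_mul, norm_zpow, Padic.norm_p, inv_zpow', zpow_neg]
  -- `k ≥ 0` from the unit coefficient of `L`
  obtain ⟨n, hn⟩ := hunit
  have hle : (p : ℝ) ^ (-k) ≤ 1 := by
    have h1 : ‖((PowerSeries.coeff n g : ℤ_[p]) : ℚ_[p])‖ ≤ 1 := by
      rw [PadicInt.padic_norm_e_of_padicInt]; exact PadicInt.norm_le_one _
    rw [hcoeff n, hn, mul_one] at h1
    exact h1
  have hk0 : 0 ≤ k := by
    by_contra hlt
    rw [not_le] at hlt
    have : (1 : ℝ) < (p : ℝ) ^ (-k) := one_lt_zpow₀ hp1 (by omega)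
    linarith
  -- `k ≤ 0` from a unit coefficient of `g`
  obtain ⟨m, hm⟩ := (GreenbergVatsal2000.hasUnitContent_iff_exists_norm_eq_one g).mp hg
  have hge : (1 : ℝ) ≤ (p : ℝ) ^ (-k) := by
    have h1 : ‖((PowerSeries.coeff m g : ℤ_[p]) : ℚ_[p])‖ = 1 := by
      rw [PadicInt.padic_norm_e_of_padicInt]; exact hm
    rw [hcoeff m] at h1
    have hL1 : ‖PowerSeries.coeff m L‖ ≤ 1 := hint m
    have hpos : 0 ≤ (p : ℝ) ^ (-k) := zpow_nonneg (by positivity) _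
    nlinarith
  have hk1 : k ≤ 0 := by
    by_contra hlt
    rw [not_le] at hlt
    have h2 : (1 : ℝ) < (p : ℝ) ^ k := one_lt_zpow₀ hp1 hlt
    have h3 : (p : ℝ) ^ (-k) < 1 := by
      rw [zpow_neg]; exact inv_lt_one_of_one_lt₀ h2
    linarith
  omega

/-- **Conversely, exponent `0` gives `μ(g) = 0`**: if `ι g = L` and some coefficient of `L` has norm
`1`, then `g` has unit content. [folklore] -/
theorem hasUnitContent_of_map_eq {p : ℕ} [Fact p.Prime] (g : IwasawaAlgebra p)
    (L : PowerSeries ℚ_[p]) (h : iwasawaToPowerSeries p g = L)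
    (hunit : ∃ n : ℕ, ‖PowerSeries.coeff n L‖ = 1) : GreenbergVatsal2000.HasUnitContent g := by
  rw [GreenbergVatsal2000.hasUnitContent_iff_exists_norm_coeff_map_eq_one, h]
  exact hunit

/-! ### The period ratio is a `p`-adic unit (bookkeeping) -/

/-- For `p ≥ 5` good with `E[p]` irreducible and `f` a newform of `E`, the rational `ϖ` with
`ϖ·Ω_E = Ω⁺_f` has `‖ϖ‖_p = 1` (from the named fact `realPeriodRat_eq_unit_mul_plusPeriod`:
`Ω_E = u·Ω⁺_f`, `‖u‖_p = 1`, and `Ω⁺_f > 0`). [cite: GreenbergVatsal2000, §3 Remark (3.4)] -/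
theorem norm_periodRatio_eq_one (h5 : realPeriodRat_eq_unit_mul_plusPeriod)
    (W : WeierstrassCurve ℚ) [W.IsElliptic] [W.IsGloballyMinimal] (p : ℕ) [Fact p.Prime]
    (hp : 5 ≤ p) (hgood : W.HasGoodReductionAtPrime p) (hirr : W.HasIrreducibleModPGaloisRep p)
    {N : ℕ} [NeZero N] (f : CuspForm (Gamma0 N) 2) (hf : IsNewformOf W f) (ϖ : ℚ)
    (hϖeq : (ϖ : ℝ) * W.realPeriodRat = plusPeriod f) : ‖(ϖ : ℚ_[p])‖ = 1 := by
  have hplus : plusPeriod f ≠ 0 :=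
    (IsNewform0.plusPeriod_pos_holds hf.1 hf.coeffField_eq_bot).ne'
  obtain ⟨u, hu1, huΩ⟩ := h5 W p hp hgood hirr f hf
  have hϖu : ϖ * u = 1 := by
    have h1 : ((ϖ * u : ℚ) : ℝ) * plusPeriod f = ((1 : ℚ) : ℝ) * plusPeriod f := by
      calc ((ϖ * u : ℚ) : ℝ) * plusPeriod f = (ϖ : ℝ) * ((u : ℝ) * plusPeriod f) := by
            push_cast; ring
        _ = (ϖ : ℝ) * W.realPeriodRat := by rw [← huΩ]
        _ = plusPeriod f := hϖeq
        _ = ((1 : ℚ) : ℝ) * plusPeriod f := by push_cast; rw [one_mul]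
    exact_mod_cast mul_right_cancel₀ hplus h1
  have h := congrArg (fun r : ℚ => ‖(r : ℚ_[p])‖) hϖu
  simp only [Rat.cast_mul, norm_mul, hu1, mul_one, Rat.cast_one, norm_one] at h
  exact h

/-! ### `μ = 0` + certificate ⟹ the integral main conjecture (pointwise) -/

/-- **Greenberg's `μ = 0` for `(E, p)` plus one unit coefficient of `L_p(E)` give the INTEGRAL
cyclotomic main conjecture at a good ordinary irreducible prime `p ≥ 5`.** For the cyclotomic data
`(κ, γ)`, a newform `f` of `E = W` and a dual datum `D`: if `μ(X(E/ℚ_∞)) = 0` (`hμ : D.mu = 0` —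
Greenberg, LNM 1716 Conj. 1.11 for this pair; OPEN, an explicit hypothesis) and some coefficient of
`L_p(f, α)` is a `p`-adic unit (`hcert`, a finite modular-symbol certificate), then `X` is
`Λ`-torsion and `char_Λ X = (g)` with `ι g = L_p(f, α)` — BCS 2025 Thm. 1.1.2 (b)'s conclusion
without (im). Proof: BCS (a) gives `ι g = p^k L_p(f,α)`; `L_p(f,α) ∈ Λ` (Greenberg–Vatsal Prop. 3.7,
tree theorem `padicLFunction_mem_integral_holds`); `exponent_eq_zero_of_hasUnitContent`.
[cite: BurungaleCastellaSkinner2025, Thm. 1.1.2 (a) (p. 2 of arXiv:2405.00270v2)]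
[cite: GreenbergVatsal2000, Prop. 3.7] [cite: GreenbergLNM1716, §1 Conj. 1.11] -/
theorem mazurMainConjecture_of_mu_eq_zero
    (hBCS : burungale_castella_skinner_charIdeal_eq_padicLFunction)
    (W : WeierstrassCurve ℚ) [W.IsElliptic] [W.IsGloballyMinimal] (p : ℕ) [Fact p.Prime]
    (hp : 5 ≤ p) (hgood : W.HasGoodReductionAtPrime p) (hord : ¬ (p : ℤ) ∣ W.frobeniusTrace p)
    (hirr : W.HasIrreducibleModPGaloisRep p)
    (κ : ZpExtension ℚ p) (γ : Field.absoluteGaloisGroup ℚ) (hκ : κ.IsCyclotomic)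
    (hγ : κ.IsTopGenerator γ) (hγ' : IsCyclotomicVariable p γ)
    {N : ℕ} [NeZero N] (f : CuspForm (Gamma0 N) 2) (hf : IsNewformOf W f)
    (D : W.SelmerDualData κ γ) (hμ : D.mu = 0)
    (hcert : ∃ n : ℕ, ‖PowerSeries.coeff n (padicLFunction f (unitRoot W p : ℚ_[p]))‖ = 1) :
    D.IsTorsion ∧
      ∃ g : IwasawaAlgebra p, D.charIdeal = Ideal.span {g} ∧
        iwasawaToPowerSeries p g = padicLFunction f (unitRoot W p : ℚ_[p]) := by
  have hp2 : p ≠ 2 := by omega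
  have hordp : IsOrdinaryAt W p := ⟨hgood, hord⟩
  haveI : Module.Finite (IwasawaAlgebra p) D.X := D.module_finite_holds hγ
  obtain ⟨hX, g, k, hchar, hιg⟩ := hBCS W p κ γ f hp hgood hord hirr hκ hγ hγ' hf D
  have hg : GreenbergVatsal2000.HasUnitContent g :=
    (GreenbergVatsal2000.mu_eq_zero_iff_hasUnitContent D hX hchar).mp hμ
  have hint : ∀ n : ℕ, ‖PowerSeries.coeff n (padicLFunction f (unitRoot W p : ℚ_[p]))‖ ≤ 1 := by
    intro n
    rw [coeff_padicLFunction]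
    exact padicLFunction_mem_integral_holds hp2 hordp hf hirr n
  have hk : k = 0 := exponent_eq_zero_of_hasUnitContent g _ k hιg hint hcert hg
  refine ⟨hX, g, hchar, ?_⟩
  rw [hιg, hk, zpow_zero, map_one, one_mul]

/-- **Conversely: the integral main conjecture plus the certificate give `μ = 0`.** If `X` is
torsion with `char_Λ X = (g)`, `ι g = L_p(f, α)`, and some coefficient of `L_p(f, α)` is a unit, then
`μ(X) = 0`. [cite: GreenbergVatsal2000, p. 2, (1)–(2)] -/
theorem mu_eq_zero_of_charIdeal_eq {p : ℕ} [Fact p.Prime]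
    {W : WeierstrassCurve ℚ} [W.IsElliptic] {κ : ZpExtension ℚ p} {γ : Field.absoluteGaloisGroup ℚ}
    (hγ : κ.IsTopGenerator γ) (D : W.SelmerDualData κ γ) (hX : D.IsTorsion) (g : IwasawaAlgebra p)
    (hchar : D.charIdeal = Ideal.span {g}) (L : PowerSeries ℚ_[p])
    (hιg : iwasawaToPowerSeries p g = L) (hcert : ∃ n : ℕ, ‖PowerSeries.coeff n L‖ = 1) :
    D.mu = 0 := by
  haveI : Module.Finite (IwasawaAlgebra p) D.X := D.module_finite_holds hγ
  exact (GreenbergVatsal2000.mu_eq_zero_iff_hasUnitContent D hX hchar).mpr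
    (hasUnitContent_of_map_eq g L hιg hcert)

/-! ### Mazur's normalisation: the main conjecture for `(E, p)` from `μ = 0`, all data -/

/-- **Mazur's main conjecture for `(E, p)` in the Néron normalisation, from `μ = 0` and the
certificate.** For `W` globally minimal, `p ≥ 5` good ordinary with `E[p]` irreducible, assume
`μ(X(E/ℚ_∞)) = 0` for every cyclotomic dual datum (`hμ`; Greenberg's Conj. 1.11 for this pair, OPEN)
and the certificate `hcert`: for every newform `f` of `E` at level `N_E` and `ϖ·Ω_E = Ω⁺_f`, SOME
coefficient of `𝓛_MSD(E) = ϖ·L_p(f, α)` is a `p`-adic unit (the lane's "`μ(𝓛_p(E)) = 0`"; `ϖ` is a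
unit, `norm_periodRatio_eq_one`). Then for all cyclotomic data, newforms `f`, such `ϖ` and dual data
`D`: `X` torsion, `char X = (g)`, `ι g = ϖ·L_p(f, α)` — the hypothesis shape `hMC` of the cell's
rank-0 glue and rank-1 engine. [cite: BurungaleCastellaSkinner2025, Thm. 1.1.2 (a) (p. 2 of arXiv:2405.00270v2)]
[cite: GreenbergVatsal2000, Prop. 3.7 and §3 Remark (3.4)] -/
theorem mazurMainConjecture_neron_of_mu_eq_zero
    (hBCS : burungale_castella_skinner_charIdeal_eq_padicLFunction)
    (h5 : realPeriodRat_eq_unit_mul_plusPeriod)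
    (W : WeierstrassCurve ℚ) [W.IsElliptic] [W.IsGloballyMinimal] (p : ℕ) [Fact p.Prime]
    (hp : 5 ≤ p) (hgood : W.HasGoodReductionAtPrime p) (hord : ¬ (p : ℤ) ∣ W.frobeniusTrace p)
    (hirr : W.HasIrreducibleModPGaloisRep p)
    (hμ : ∀ (κ : ZpExtension ℚ p) (γ : Field.absoluteGaloisGroup ℚ),
        κ.IsCyclotomic → κ.IsTopGenerator γ → IsCyclotomicVariable p γ →
      ∀ (D : W.SelmerDualData κ γ), D.mu = 0)
    (hcert : ∀ [NeZero (W.conductorNorm ℤ)] (f : CuspForm (Gamma0 (W.conductorNorm ℤ)) 2),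
        IsNewformOf W f → ∀ (ϖ : ℚ), (ϖ : ℝ) * W.realPeriodRat = plusPeriod f →
      ∃ n : ℕ, ‖PowerSeries.coeff n
        (PowerSeries.C (ϖ : ℚ_[p]) * padicLFunction f (unitRoot W p : ℚ_[p]))‖ = 1) :
    ∀ (κ : ZpExtension ℚ p) (γ : Field.absoluteGaloisGroup ℚ),
        κ.IsCyclotomic → κ.IsTopGenerator γ → IsCyclotomicVariable p γ →
      ∀ [NeZero (W.conductorNorm ℤ)] (f : CuspForm (Gamma0 (W.conductorNorm ℤ)) 2),
        IsNewformOf W f → ∀ (ϖ : ℚ), (ϖ : ℝ) * W.realPeriodRat = plusPeriod f →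
      ∀ (D : W.SelmerDualData κ γ), D.IsTorsion ∧
        ∃ g : IwasawaAlgebra p, D.charIdeal = Ideal.span {g} ∧
          iwasawaToPowerSeries p g =
            PowerSeries.C (ϖ : ℚ_[p]) * padicLFunction f (unitRoot W p : ℚ_[p]) := by
  intro κ γ hκ hγ hγ' _ f hf ϖ hϖeq D
  have hϖnorm : ‖(ϖ : ℚ_[p])‖ = 1 := norm_periodRatio_eq_one h5 W p hp hgood hirr f hf ϖ hϖeq
  -- the certificate for `L_p(f, α)` itself (`ϖ` is a unit)
  have hcert' : ∃ n : ℕ, ‖PowerSeries.coeff n (padicLFunction f (unitRoot W p : ℚ_[p]))‖ = 1 := by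
    obtain ⟨n, hn⟩ := hcert f hf ϖ hϖeq
    refine ⟨n, ?_⟩
    rwa [PowerSeries.coeff_C_mul, norm_mul, hϖnorm, one_mul] at hn
  obtain ⟨hX, g, hchar, hιg⟩ := mazurMainConjecture_of_mu_eq_zero hBCS W p hp hgood hord hirr κ γ hκ
    hγ hγ' f hf D (hμ κ γ hκ hγ hγ' D) hcert'
  -- rescale the generator by the unit `ϖ ∈ ℤ_p^×`
  set c : ℤ_[p] := ⟨(ϖ : ℚ_[p]), hϖnorm.le⟩ with hc_def
  have hcu : IsUnit c := PadicInt.isUnit_iff.mpr hϖnorm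
  refine ⟨hX, PowerSeries.C c * g, ?_, ?_⟩
  · rw [hchar]
    exact (Ideal.span_singleton_mul_left_unit (hcu.map PowerSeries.C) g).symm
  · rw [map_mul, hιg, PowerSeries.map_C]
    rfl

/-! ### Class X9: `BSD(E,p)` from `μ = 0` and the certificate -/

section X9

variable (W : WeierstrassCurve ℚ) [W.IsElliptic] [W.IsGloballyMinimal] (p : ℕ) [Fact p.Prime]

/-- **Class X9, analytic rank 0: Greenberg's `μ = 0` for `(E, p)` + the analytic certificate ⟹
`BSD(E,p)`.** PUBLISHED binders: BCS 2025 Thm. 1.1.2 (a) (`hBCS`), Greenberg LNM 1716 Thm. 4.1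
(`hGr`), period unit (`h5`), modularity (`hmodP`, `hmodL`), GZK (`hGZK`). OPEN per-pair binder:
`hμ` (`μ(X(E/ℚ_∞)) = 0`, Greenberg Conj. 1.11 — never asserted). FINITE certificate: `hcert` (a unit
coefficient of `𝓛_MSD(E)`). Deduction: `mazurMainConjecture_neron_of_mu_eq_zero` feeds the rank-0
glue `padicValRat_bsd_rank_zero_of_mazurMainConjecture` (CGLS 2022, proof of Thm. 5.1.4) and
`bsdp_of_padicValRat_rank_zero`. [cite: GreenbergLNM1716, Thm. 4.1 (p. 102) and §1 Conj. 1.11]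
[cite: CastellaEtAl2021, Thm. 5.1.4 and its proof (§5.1.3)] -/
theorem X9.bsdp_of_mu_eq_zero
    (hBCS : burungale_castella_skinner_charIdeal_eq_padicLFunction)
    (hGr : greenberg_charValue_rankZero) (h5 : realPeriodRat_eq_unit_mul_plusPeriod)
    (hmodP : nonempty_modularParametrizationData) (hmodL : hasEntireLFunction_rat)
    (hGZK : rank_eq_analyticRank_of_analyticRank_le_one)
    (hX9 : ClassX9 W p) (hr : W.analyticRank = 0)
    (hμ : ∀ (κ : ZpExtension ℚ p) (γ : Field.absoluteGaloisGroup ℚ),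
        κ.IsCyclotomic → κ.IsTopGenerator γ → IsCyclotomicVariable p γ →
      ∀ (D : W.SelmerDualData κ γ), D.mu = 0)
    (hcert : ∀ [NeZero (W.conductorNorm ℤ)] (f : CuspForm (Gamma0 (W.conductorNorm ℤ)) 2),
        IsNewformOf W f → ∀ (ϖ : ℚ), (ϖ : ℝ) * W.realPeriodRat = plusPeriod f →
      ∃ n : ℕ, ‖PowerSeries.coeff n
        (PowerSeries.C (ϖ : ℚ_[p]) * padicLFunction f (unitRoot W p : ℚ_[p]))‖ = 1) :
    BSDp W p := by
  obtain ⟨-, ⟨hgood, hord⟩, hp, hirr, -, -⟩ := id hX9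
  have hp2 : p ≠ 2 := by omega
  have hL : W.entireLFunction 1 ≠ 0 := (W.analyticRank_eq_zero_iff_holds (hmodL W)).1 hr
  have hfin : Finite W.sha := (hGZK W (by omega)).2
  exact bsdp_of_padicValRat_rank_zero W p hr hL hGZK
    (padicValRat_bsd_rank_zero_of_mazurMainConjecture W p hgood hord hL hfin hmodP
      (hGr W p hp2 hgood hord)
      (mazurMainConjecture_neron_of_mu_eq_zero hBCS h5 W p hp hgood hord hirr hμ hcert))

/-- **Class X9, analytic rank 1: Greenberg's `μ = 0` + the analytic certificate + the Schneider
certificate C3 ⟹ `BSD(E,p)`**, through the cell's rank-one engine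
`Wuthrich2014.missingPPartAt_of_mainConjecture_of_rank_one` (Perrin-Riou–Schneider `hS`,
Perrin-Riou 1987 `hPR`; any image of `ρ̄_{E,p}`). In rank 1 the constant term of `𝓛_MSD(E)`
vanishes, so the certificate is a coefficient of index `≥ 1` (e.g. `[T¹]`, which then also yields C3
by `…_of_coeff_one`). [cite: PerrinRiou1987, §1.4 Cor. 1.8] [cite: BalakrishnanMullerStein2015, Thm. 1.7]
[cite: GreenbergLNM1716, §1 Conj. 1.11] -/
theorem X9.bsdp_of_mu_eq_zero_of_analyticRank_eq_one
    (hBCS : burungale_castella_skinner_charIdeal_eq_padicLFunction)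
    (h5 : realPeriodRat_eq_unit_mul_plusPeriod)
    (hS : Schneider1985_order_charGenerator) (hPR : perrinRiou_rankOne_leadingTerms)
    (hmodP : nonempty_modularParametrizationData)
    (hGZK : rank_eq_analyticRank_of_analyticRank_le_one)
    (hX9 : ClassX9 W p) (hr : W.analyticRank = 1)
    (hμ : ∀ (κ : ZpExtension ℚ p) (γ : Field.absoluteGaloisGroup ℚ),
        κ.IsCyclotomic → κ.IsTopGenerator γ → IsCyclotomicVariable p γ →
      ∀ (D : W.SelmerDualData κ γ), D.mu = 0)
    (hcert : ∀ [NeZero (W.conductorNorm ℤ)] (f : CuspForm (Gamma0 (W.conductorNorm ℤ)) 2),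
        IsNewformOf W f → ∀ (ϖ : ℚ), (ϖ : ℝ) * W.realPeriodRat = plusPeriod f →
      ∃ n : ℕ, ‖PowerSeries.coeff n
        (PowerSeries.C (ϖ : ℚ_[p]) * padicLFunction f (unitRoot W p : ℚ_[p]))‖ = 1)
    (hC3 : ∀ Dh : PAdicHeightData W p, Dh.IsCanonical → SchneiderConjecture Dh) :
    BSDp W p := by
  obtain ⟨-, ⟨hgood, hord⟩, hp, hirr, -, -⟩ := id hX9
  exact Typed.bsdp_of_missingPPartAt W p hGZK (by omega)
    (Wuthrich2014.missingPPartAt_of_mainConjecture_of_rank_one hS hPR hmodP hGZK W p hp hgood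
      hord hr hC3 (mazurMainConjecture_neron_of_mu_eq_zero hBCS h5 W p hp hgood hord hirr hμ hcert))

/-- **Rank 1 with both certificates read off one coefficient**: if `[T¹]L_p(f, α) ≠ 0` is moreover a
`p`-adic UNIT for the newform `f` of `E` at level `N_E`, it is at once the analytic certificate
(`μ(𝓛) = 0`) and — via `Wuthrich2014.coeff_one_padicLFunction_ne_zero_iff_schneider` — the
Schneider certificate C3; so `μ(X) = 0` alone (OPEN) then gives `BSD(E,p)`.
[cite: PerrinRiou1987, §1.4 Cor. 1.8] [cite: SteinWuthrich2013, §§3–4 and §9] -/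
theorem X9.bsdp_of_mu_eq_zero_of_norm_coeff_one_eq_one
    (hBCS : burungale_castella_skinner_charIdeal_eq_padicLFunction)
    (h5 : realPeriodRat_eq_unit_mul_plusPeriod)
    (hS : Schneider1985_order_charGenerator) (hPR : perrinRiou_rankOne_leadingTerms)
    (hmodP : nonempty_modularParametrizationData)
    (hGZK : rank_eq_analyticRank_of_analyticRank_le_one)
    (hX9 : ClassX9 W p) (hr : W.analyticRank = 1)
    (hμ : ∀ (κ : ZpExtension ℚ p) (γ : Field.absoluteGaloisGroup ℚ),
        κ.IsCyclotomic → κ.IsTopGenerator γ → IsCyclotomicVariable p γ →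
      ∀ (D : W.SelmerDualData κ γ), D.mu = 0)
    (hone : ∀ [NeZero (W.conductorNorm ℤ)] (f : CuspForm (Gamma0 (W.conductorNorm ℤ)) 2),
        IsNewformOf W f → ‖PowerSeries.coeff 1 (padicLFunction f (unitRoot W p : ℚ_[p]))‖ = 1) :
    BSDp W p := by
  obtain ⟨-, ⟨hgood, hord⟩, hp, hirr, -, -⟩ := id hX9
  haveI : NeZero (W.conductorNorm ℤ) := ⟨(W.conductorNorm_pos_holds).ne'⟩
  obtain ⟨Dm⟩ := hmodP W
  have hf : IsNewformOf W Dm.f := Dm.isNewformOf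
  have h1 := hone Dm.f hf
  have hne : PowerSeries.coeff 1 (padicLFunction Dm.f (unitRoot W p : ℚ_[p])) ≠ 0 :=
    norm_pos_iff.mp (by rw [h1]; exact one_pos)
  refine X9.bsdp_of_mu_eq_zero_of_analyticRank_eq_one W p hBCS h5 hS hPR hmodP hGZK hX9 hr hμ
    ?_ fun Dh hDh => ?_
  · intro _ f hf' ϖ hϖeq
    refine ⟨1, ?_⟩
    rw [PowerSeries.coeff_C_mul, norm_mul, norm_periodRatio_eq_one h5 W p hp hgood hirr f hf' ϖ hϖeq,
      one_mul]
    exact hone f hf'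
  · exact (Wuthrich2014.coeff_one_padicLFunction_ne_zero_iff_schneider hPR hGZK W p hp
      ⟨hgood, hord⟩ hr Dh hDh Dm.f hf).mp hne

/-- **Class X9 in the canonical cell shape, both ranks: `μ = 0` (OPEN, per pair) + certificates ⟹
`BSD(E,p)`.** [cite: GreenbergLNM1716, Thm. 4.1 (p. 102) and §1 Conj. 1.11] [cite: PerrinRiou1987, §1.4 Cor. 1.8] -/
theorem X9.bsdp_of_mu_eq_zero_of_analyticRank_le_one
    (hBCS : burungale_castella_skinner_charIdeal_eq_padicLFunction)
    (hGr : greenberg_charValue_rankZero) (h5 : realPeriodRat_eq_unit_mul_plusPeriod)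
    (hS : Schneider1985_order_charGenerator) (hPR : perrinRiou_rankOne_leadingTerms)
    (hmodP : nonempty_modularParametrizationData) (hmodL : hasEntireLFunction_rat)
    (hGZK : rank_eq_analyticRank_of_analyticRank_le_one)
    (hran : W.analyticRank ≤ 1) (hX9 : ClassX9 W p)
    (hμ : ∀ (κ : ZpExtension ℚ p) (γ : Field.absoluteGaloisGroup ℚ),
        κ.IsCyclotomic → κ.IsTopGenerator γ → IsCyclotomicVariable p γ →
      ∀ (D : W.SelmerDualData κ γ), D.mu = 0)
    (hcert : ∀ [NeZero (W.conductorNorm ℤ)] (f : CuspForm (Gamma0 (W.conductorNorm ℤ)) 2),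
        IsNewformOf W f → ∀ (ϖ : ℚ), (ϖ : ℝ) * W.realPeriodRat = plusPeriod f →
      ∃ n : ℕ, ‖PowerSeries.coeff n
        (PowerSeries.C (ϖ : ℚ_[p]) * padicLFunction f (unitRoot W p : ℚ_[p]))‖ = 1)
    (hC3 : W.analyticRank = 1 → ∀ Dh : PAdicHeightData W p, Dh.IsCanonical → SchneiderConjecture Dh) :
    BSDp W p := by
  rcases Nat.le_one_iff_eq_zero_or_eq_one.mp hran with hr | hr
  · exact X9.bsdp_of_mu_eq_zero W p hBCS hGr h5 hmodP hmodL hGZK hX9 hr hμ hcert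
  · exact X9.bsdp_of_mu_eq_zero_of_analyticRank_eq_one W p hBCS h5 hS hPR hmodP hGZK hX9 hr hμ
      hcert (hC3 hr)

/-- **The typed X9 output from `μ = 0` + certificates** (`Typed.X9.MissingInputAt W p`).
[cite: Miller2011LMS, Def. 1.1] [cite: GreenbergLNM1716, §1 Conj. 1.11] -/
theorem X9.missingInputAt_of_mu_eq_zero
    (hBCS : burungale_castella_skinner_charIdeal_eq_padicLFunction)
    (hGr : greenberg_charValue_rankZero) (h5 : realPeriodRat_eq_unit_mul_plusPeriod)
    (hS : Schneider1985_order_charGenerator) (hPR : perrinRiou_rankOne_leadingTerms)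
    (hmodP : nonempty_modularParametrizationData) (hmodL : hasEntireLFunction_rat)
    (hGZK : rank_eq_analyticRank_of_analyticRank_le_one)
    (hran : W.analyticRank ≤ 1) (hX9 : ClassX9 W p)
    (hμ : ∀ (κ : ZpExtension ℚ p) (γ : Field.absoluteGaloisGroup ℚ),
        κ.IsCyclotomic → κ.IsTopGenerator γ → IsCyclotomicVariable p γ →
      ∀ (D : W.SelmerDualData κ γ), D.mu = 0)
    (hcert : ∀ [NeZero (W.conductorNorm ℤ)] (f : CuspForm (Gamma0 (W.conductorNorm ℤ)) 2),
        IsNewformOf W f → ∀ (ϖ : ℚ), (ϖ : ℝ) * W.realPeriodRat = plusPeriod f →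
      ∃ n : ℕ, ‖PowerSeries.coeff n
        (PowerSeries.C (ϖ : ℚ_[p]) * padicLFunction f (unitRoot W p : ℚ_[p]))‖ = 1)
    (hC3 : W.analyticRank = 1 → ∀ Dh : PAdicHeightData W p, Dh.IsCanonical → SchneiderConjecture Dh) :
    Typed.X9.MissingInputAt W p := by
  haveI : Finite W.sha := (hGZK W hran).2
  exact Typed.X9.missingInputAt_of_bsdp W p
    (X9.bsdp_of_mu_eq_zero_of_analyticRank_le_one W p hBCS hGr h5 hS hPR hmodP hmodL hGZK hran hX9
      hμ hcert hC3)

end X9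

/-! ### The converse in analytic rank 0: `BSD(E,p)` + certificate ⟹ `μ = 0`

The valuation chain of Castella–Grossi–Lee–Skinner 2022, proof of Thm. 5.1.4 (tree theorem
`padicValRat_bsd_rank_zero_of_mazurMainConjecture`, whose proof is followed here line by line —
adapted from `LeadingTermPPartEisensteinProofs`), run with a main conjecture "up to `p^k`":
`char X = (g)`, `ι g = p^k · L_p(f, α)`. The outcome is the print shape SHIFTED BY `k`:
`ord_p(L(E,1)/Ω_E) + k = ord_p #Ш + ord_p ∏ c_ℓ - 2 ord_p #E(ℚ)_tors`. Hence, given BCS (a), Miller's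
`BSD(E,p)` in rank 0 says exactly `k = 0`, i.e. (with the certificate) `μ(X) = 0`. -/

/-- **The rank-0 valuation chain with an exponent.** Let `W` be globally minimal, `p` good ordinary,
`L(E,1) ≠ 0`, `Ш` finite, Greenberg's Thm. 4.1 for `(E,p)` (`hGr`, inline), the cyclotomic data
`(κ, γ)`, a newform `f` of `E`, the rational `ϖ` with `ϖ·Ω_E = Ω⁺_f` and `ord_p ϖ = 0`, a dual datum
`D` with `X` torsion and `char X = (g)` where `ι g = p^k · L_p(f, α)` for some `k ∈ ℤ`. Then
`L(E,1)/Ω_E = q ∈ ℚ` with `ord_p q + k = ord_p #Ш(E) + ord_p ∏ c_ℓ - 2 ord_p #E(ℚ)_tors`. (For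
`k = 0` this is `padicValRat_bsd_rank_zero_of_mazurMainConjecture`.) Chain: `g(0) = p^k(1-α⁻¹)²[0]⁺_f`
(interpolation), `g(0) ≠ 0` hence `Sel_{p^∞}(E/ℚ)` finite, Greenberg's identity, `1-α⁻¹ ∼ #Ẽ(𝔽_p)(p)`,
`#Sel = #Ш[p^∞] ∼ #Ш`, `#E(ℚ)(p) ∼ #E(ℚ)_tors`, valuations.
[cite: CastellaEtAl2021, Thm. 5.1.4 and its proof (§5.1.3)]
[cite: GreenbergLNM1716, Thm. 4.1 (p. 102), proof of Lemma 4.2 (p. 103)] -/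
theorem padicValRat_lvalue_add_exponent_of_charIdeal_eq
    (W : WeierstrassCurve ℚ) [W.IsElliptic] [W.IsGloballyMinimal] (p : ℕ) [Fact p.Prime]
    (hgood : W.HasGoodReductionAtPrime p) (hord : ¬ (p : ℤ) ∣ W.frobeniusTrace p)
    (hL : W.entireLFunction 1 ≠ 0) (hfin : Finite W.sha)
    (hGr : ∀ (κ : ZpExtension ℚ p) (γ : Field.absoluteGaloisGroup ℚ),
        κ.IsCyclotomic → κ.IsTopGenerator γ → IsCyclotomicVariable p γ →
      ∀ (D : W.SelmerDualData κ γ) [Module.Finite (IwasawaAlgebra p) D.X], D.IsTorsion →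
      ∀ (fE : IwasawaAlgebra p), D.charIdeal = Ideal.span {fE} →
        Finite (W.selmerGroupPInfty p) →
        ∃ u : ℤ_[p]ˣ,
          ((PowerSeries.constantCoeff fE : ℤ_[p]) : ℚ_[p]) *
              (Nat.card (AddCommGroup.primaryComponent W.toAffine.Point p) : ℚ_[p]) ^ 2 =
            ((u : ℤ_[p]) : ℚ_[p]) * (p : ℚ_[p]) ^ (padicValNat p W.tamagawaProduct) *
              (Nat.card (AddCommGroup.primaryComponent
                ((integralModelInt W).map (Int.castRingHom (ZMod p))).toAffine.Point p) : ℚ_[p]) ^ 2 *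
              (Nat.card (W.selmerGroupPInfty p) : ℚ_[p]))
    (κ : ZpExtension ℚ p) (γ : Field.absoluteGaloisGroup ℚ) (hκ : κ.IsCyclotomic)
    (hγ : κ.IsTopGenerator γ) (hγ' : IsCyclotomicVariable p γ)
    {N : ℕ} [NeZero N] (f : CuspForm (Gamma0 N) 2) (hf : IsNewformOf W f)
    (ϖ : ℚ) (hϖeq : (ϖ : ℝ) * W.realPeriodRat = plusPeriod f) (hϖv : padicValRat p ϖ = 0)
    (D : W.SelmerDualData κ γ) (hX : D.IsTorsion) (g : IwasawaAlgebra p) (k : ℤ)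
    (hchar : D.charIdeal = Ideal.span {g})
    (hιg : iwasawaToPowerSeries p g =
      PowerSeries.C ((p : ℚ_[p]) ^ k) * padicLFunction f (unitRoot W p : ℚ_[p])) :
    ∃ q : ℚ, W.entireLFunction 1 / (W.realPeriodRat : ℂ) = (q : ℂ) ∧
      padicValRat p q + k = (padicValNat p W.shaOrder : ℤ) + padicValNat p W.tamagawaProduct -
        2 * padicValNat p W.torsionOrder := by
  -- adapted from `LeadingTermPPartEisensteinProofs.padicValRat_bsd_rank_zero_of_mazurMainConjecture`
  have hpP : p.Prime := Fact.out
  have hordp : IsOrdinaryAt W p := ⟨hgood, hord⟩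
  haveI : Module.Finite (IwasawaAlgebra p) D.X := D.module_finite_holds hγ
  have hΩpos : 0 < W.realPeriodRat := W.realPeriodRat_pos_holds
  have hplus : 0 < plusPeriod f := IsNewform0.plusPeriod_pos_holds hf.1 hf.coeffField_eq_bot
  have hϖ0 : ϖ ≠ 0 := by
    rintro rfl
    simp only [Rat.cast_zero, zero_mul] at hϖeq
    exact hplus.ne' hϖeq.symm
  -- the rational number `t = ϖ · [0]⁺_f = L(E,1)/Ω_E`
  set s : ℚ := ratPlusSymbol f 0 with hs_def
  set t : ℚ := ϖ * s with ht_def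
  have hLval : W.entireLFunction 1 = (((s : ℝ) * plusPeriod f : ℝ) : ℂ) := hf.entireLFunction_one_eq
  have hq : W.entireLFunction 1 / (W.realPeriodRat : ℂ) = ((t : ℚ) : ℂ) := by
    rw [hLval, ← hϖeq, div_eq_iff (Complex.ofReal_ne_zero.mpr hΩpos.ne'), ht_def]
    push_cast
    ring
  have hs0 : s ≠ 0 := by
    intro h0
    apply hL
    rw [hLval, h0]
    simp
  refine ⟨t, hq, ?_⟩
  -- interpolation: `g(0) = p^k · (1 - α⁻¹)² · s`
  set a : ℚ_[p] := ((unitRoot W p : ℤ_[p]) : ℚ_[p]) with ha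
  set PK : ℚ_[p] := (p : ℚ_[p]) ^ k with hPK
  have hp0 : (p : ℚ_[p]) ≠ 0 := Nat.cast_ne_zero.mpr hpP.ne_zero
  have hPK0 : PK ≠ 0 := zpow_ne_zero k hp0
  have hvPK : PK.valuation = k := by rw [hPK, Padic.valuation_zpow, Padic.valuation_p, mul_one]
  have hg0 : ((PowerSeries.constantCoeff g : ℤ_[p]) : ℚ_[p]) = PK * ((1 - a⁻¹) ^ 2 * (s : ℚ_[p])) := by
    rw [← constantCoeff_iwasawaToPowerSeries p g, hιg, map_mul, PowerSeries.constantCoeff_C,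
      constantCoeff_padicLFunction_unitRoot hordp hf]
  obtain ⟨u₂, hu₂⟩ := exists_unit_one_sub_unitRoot_inv p W hordp
  haveI : NeZero p := ⟨hpP.ne_zero⟩
  obtain ⟨u₃, hu₃⟩ := exists_unit_natCard_eq_mul_card_primaryComponent
    ((integralModelInt W).map (Int.castRingHom (ZMod p))).toAffine.Point p
  set Np : ℚ_[p] := (Nat.card (AddCommGroup.primaryComponent
    ((integralModelInt W).map (Int.castRingHom (ZMod p))).toAffine.Point p) : ℚ_[p]) with hNp
  have hNcount : (W.reductionPointCount p : ℚ_[p]) = ((u₃ : ℤ_[p]) : ℚ_[p]) * Np := by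
    rw [WeierstrassCurve.reductionPointCount, hNp]
    exact hu₃
  have hNp0 : Np ≠ 0 := by
    rw [hNp]
    exact_mod_cast Nat.card_pos.ne'
  have h1 : (1 - a⁻¹) = ((u₂ : ℤ_[p]) : ℚ_[p]) * ((u₃ : ℤ_[p]) : ℚ_[p]) * Np := by
    rw [hu₂, hNcount, mul_assoc]
  have hsQ0 : (s : ℚ_[p]) ≠ 0 := by exact_mod_cast hs0
  have hU0 : ((u₂ : ℤ_[p]) : ℚ_[p]) * ((u₃ : ℤ_[p]) : ℚ_[p]) ≠ 0 :=
    mul_ne_zero (coe_units_ne_zero p u₂) (coe_units_ne_zero p u₃)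
  -- finiteness of `Sel_{p^∞}(E/ℚ)` from `g(0) ≠ 0`
  have hg00 : PowerSeries.constantCoeff g ≠ 0 := by
    intro h
    rw [h, PadicInt.coe_zero, h1] at hg0
    exact (mul_ne_zero hPK0 (mul_ne_zero (pow_ne_zero 2 (mul_ne_zero hU0 hNp0)) hsQ0)) hg0.symm
  have hSelfin : Finite (W.selmerGroupPInfty p) :=
    D.finite_selmerGroupPInfty_of_constantCoeff_ne_zero W hγ hX g hchar hg00
  obtain ⟨hEfin, hShapfin⟩ := (W.finite_selmerGroupPInfty_iff p).mp hSelfin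
  haveI := hEfin
  haveI := hShapfin
  haveI := hSelfin
  haveI : Finite W.sha := hfin
  -- Greenberg's Thm. 4.1 and the remaining bridges
  obtain ⟨u₁, hu₁⟩ := hGr κ γ hκ hγ hγ' D hX g hchar hSelfin
  obtain ⟨u₄, hu₄⟩ := exists_unit_torsionOrder_eq W p
  obtain ⟨u₅, hu₅⟩ := exists_unit_natCard_eq_mul_card_primaryComponent W.sha p
  have hSel : Nat.card (W.selmerGroupPInfty p) = Nat.card (AddCommGroup.primaryComponent W.sha p) :=
    W.natCard_selmerGroupPInfty_eq_natCard_primaryComponent_sha p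
  set v := padicValNat p W.tamagawaProduct with hv
  set Tp : ℚ_[p] := (Nat.card (AddCommGroup.primaryComponent W.toAffine.Point p) : ℚ_[p]) with hTp
  set Shp : ℚ_[p] := (Nat.card (AddCommGroup.primaryComponent W.sha p) : ℚ_[p]) with hShp
  have hu₄' : (W.torsionOrder : ℚ_[p]) = ((u₄ : ℤ_[p]) : ℚ_[p]) * Tp := by
    rw [hu₄, hTp]
    congr 1
    exact_mod_cast natCard_primaryComponent_point_congr W p _ _
  have hSha : (W.shaOrder : ℚ_[p]) = ((u₅ : ℤ_[p]) : ℚ_[p]) * Shp := by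
    rw [WeierstrassCurve.shaOrder, hShp]
    exact hu₅
  have hSel' : (Nat.card (W.selmerGroupPInfty p) : ℚ_[p]) = Shp := by rw [hShp, hSel]
  -- the identity `PK · s · Tp² · (u₂ u₃)² = u₁ · p^v · Shp` in `ℚ_p`
  have key : PK * (s : ℚ_[p]) * Tp ^ 2 * (((u₂ : ℤ_[p]) : ℚ_[p]) * ((u₃ : ℤ_[p]) : ℚ_[p])) ^ 2 =
      ((u₁ : ℤ_[p]) : ℚ_[p]) * (p : ℚ_[p]) ^ v * Shp := by
    apply mul_right_cancel₀ (pow_ne_zero 2 hNp0)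
    calc PK * (s : ℚ_[p]) * Tp ^ 2 * (((u₂ : ℤ_[p]) : ℚ_[p]) * ((u₃ : ℤ_[p]) : ℚ_[p])) ^ 2 * Np ^ 2
        = (PK * ((1 - a⁻¹) ^ 2 * (s : ℚ_[p]))) * Tp ^ 2 := by rw [h1]; ring
      _ = ((u₁ : ℤ_[p]) : ℚ_[p]) * (p : ℚ_[p]) ^ v * Np ^ 2 *
            (Nat.card (W.selmerGroupPInfty p) : ℚ_[p]) := by rw [← hg0, hu₁]
      _ = ((u₁ : ℤ_[p]) : ℚ_[p]) * (p : ℚ_[p]) ^ v * Shp * Np ^ 2 := by rw [hSel']; ring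
  -- valuations
  have hTp0 : Tp ≠ 0 := by rw [hTp]; exact_mod_cast Nat.card_pos.ne'
  have hShp0 : Shp ≠ 0 := by rw [hShp]; exact_mod_cast Nat.card_pos.ne'
  have hval := congrArg Padic.valuation key
  rw [Padic.valuation_mul (mul_ne_zero (mul_ne_zero hPK0 hsQ0) (pow_ne_zero 2 hTp0)) (pow_ne_zero 2 hU0),
    Padic.valuation_mul (mul_ne_zero hPK0 hsQ0) (pow_ne_zero 2 hTp0),
    Padic.valuation_mul hPK0 hsQ0, hvPK, Padic.valuation_pow, Padic.valuation_pow,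
    Padic.valuation_mul (coe_units_ne_zero p u₂) (coe_units_ne_zero p u₃),
    valuation_coe_units_eq_zero, valuation_coe_units_eq_zero,
    Padic.valuation_mul (mul_ne_zero (coe_units_ne_zero p u₁) (pow_ne_zero v hp0)) hShp0,
    Padic.valuation_mul (coe_units_ne_zero p u₁) (pow_ne_zero v hp0), valuation_coe_units_eq_zero,
    Padic.valuation_pow, Padic.valuation_p, Padic.valuation_ratCast] at hval
  have hvT : Tp.valuation = (padicValNat p W.torsionOrder : ℤ) := by
    have h := congrArg Padic.valuation hu₄'
    rw [Padic.valuation_natCast, Padic.valuation_mul (coe_units_ne_zero p u₄) hTp0,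
      valuation_coe_units_eq_zero, zero_add] at h
    exact h.symm
  have hvS : Shp.valuation = (padicValNat p W.shaOrder : ℤ) := by
    have h := congrArg Padic.valuation hSha
    rw [Padic.valuation_natCast, Padic.valuation_mul (coe_units_ne_zero p u₅) hShp0,
      valuation_coe_units_eq_zero, zero_add] at h
    exact h.symm
  rw [hvT, hvS] at hval
  simp only [Nat.cast_ofNat, mul_zero, add_zero, zero_add] at hval
  have ht : padicValRat p t = padicValRat p s := by
    rw [ht_def, padicValRat.mul hϖ0 hs0, hϖv, zero_add]
  rw [ht]
  linarith

section X9converse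

variable (W : WeierstrassCurve ℚ) [W.IsElliptic] [W.IsGloballyMinimal] (p : ℕ) [Fact p.Prime]

/-- **Class X9, analytic rank 0, CONVERSE: `BSD(E,p)` + the analytic certificate ⟹ `μ(X(E/ℚ_∞)) = 0`
for every cyclotomic dual datum.** PUBLISHED binders `hBCS`, `hGr`, `h5`, `hmodP`, `hmodL`, `hGZK`;
`ClassX9 W p`, `W.analyticRank = 0`, Miller's `BSDp W p`; the certificate `hcert`. Proof: BCS (a) gives
`char X = (g)`, `ι g = p^k L_p(f,α)` for the newform `f` of modularity; the chain
`padicValRat_lvalue_add_exponent_of_charIdeal_eq` gives `ord_p(L(E,1)/Ω_E) + k = ord_p #Ш + ord_p ∏c_ℓ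
- 2 ord_p #E(ℚ)_tors`, while `BSDp W p` (with `Reg = 1`, `L^{(0)}(E,1)/0! = L(E,1)`,
`ord_p #Ш_an = ord_p #Ш[p^∞] = ord_p #Ш`) gives the same identity without `k`; so `k = 0`,
`ι g = L_p(f, α)`, and the unit coefficient of `L_p` is a unit coefficient of `g`: `μ = 0`
(`mu_eq_zero_of_charIdeal_eq`, then `SelmerDualData.mu_eq` for the other data of the same `(κ, γ)`).
[cite: CastellaEtAl2021, Thm. 5.1.4 and its proof (§5.1.3)] [cite: Miller2011LMS, Def. 1.1]
[cite: GreenbergLNM1716, Thm. 4.1 (p. 102) and §1 Conj. 1.11] -/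
theorem X9.mu_eq_zero_of_bsdp
    (hBCS : burungale_castella_skinner_charIdeal_eq_padicLFunction)
    (hGr : greenberg_charValue_rankZero) (h5 : realPeriodRat_eq_unit_mul_plusPeriod)
    (hmodP : nonempty_modularParametrizationData) (hmodL : hasEntireLFunction_rat)
    (hGZK : rank_eq_analyticRank_of_analyticRank_le_one)
    (hX9 : ClassX9 W p) (hr : W.analyticRank = 0) (hbsd : BSDp W p)
    (hcert : ∀ [NeZero (W.conductorNorm ℤ)] (f : CuspForm (Gamma0 (W.conductorNorm ℤ)) 2),
        IsNewformOf W f → ∀ (ϖ : ℚ), (ϖ : ℝ) * W.realPeriodRat = plusPeriod f →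
      ∃ n : ℕ, ‖PowerSeries.coeff n
        (PowerSeries.C (ϖ : ℚ_[p]) * padicLFunction f (unitRoot W p : ℚ_[p]))‖ = 1) :
    ∀ (κ : ZpExtension ℚ p) (γ : Field.absoluteGaloisGroup ℚ),
        κ.IsCyclotomic → κ.IsTopGenerator γ → IsCyclotomicVariable p γ →
      ∀ (D : W.SelmerDualData κ γ), D.mu = 0 := by
  intro κ γ hκ hγ hγ' D
  obtain ⟨-, ⟨hgood, hord⟩, hp, hirr, -, -⟩ := id hX9
  have hpP : p.Prime := Fact.out
  have hp2 : p ≠ 2 := by omega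
  have hL : W.entireLFunction 1 ≠ 0 := (W.analyticRank_eq_zero_iff_holds (hmodL W)).1 hr
  have hfin : Finite W.sha := (hGZK W (by omega)).2
  -- the newform and the period ratio
  haveI : NeZero (W.conductorNorm ℤ) := ⟨(W.conductorNorm_pos_holds).ne'⟩
  obtain ⟨Dm⟩ := hmodP W
  have hf : IsNewformOf W Dm.f := Dm.isNewformOf
  obtain ⟨ϖ, hϖpos, hϖeq, -⟩ := Dm.exists_rat_mul_realPeriodRat_eq_plusPeriod
  have hϖnorm : ‖(ϖ : ℚ_[p])‖ = 1 := norm_periodRatio_eq_one h5 W p hp hgood hirr Dm.f hf ϖ hϖeq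
  have hϖv : padicValRat p ϖ = 0 := by
    have h := Padic.norm_eq_zpow_neg_valuation (show ((ϖ : ℚ) : ℚ_[p]) ≠ 0 by exact_mod_cast hϖpos.ne')
    rw [hϖnorm, Padic.valuation_ratCast] at h
    have hp1 : (1 : ℝ) < p := by exact_mod_cast hpP.one_lt
    have h0 : (p : ℝ) ^ (0 : ℤ) = (p : ℝ) ^ (-padicValRat p ϖ) := by rw [zpow_zero]; exact h
    have := zpow_right_injective₀ (zero_lt_one.trans hp1) hp1.ne' h0
    omega
  -- BCS (a) for `(κ, γ, f, D)`
  obtain ⟨hX, g, k, hchar, hιg⟩ := hBCS W p κ γ Dm.f hp hgood hord hirr hκ hγ hγ' hf D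
  -- the chain with exponent `k`
  obtain ⟨t, htq, hval⟩ := padicValRat_lvalue_add_exponent_of_charIdeal_eq W p hgood hord hL hfin
    (hGr W p hp2 hgood hord) κ γ hκ hγ hγ' Dm.f hf ϖ hϖeq hϖv D hX g k hchar hιg
  -- the same identity without `k`, from `BSDp W p`
  obtain ⟨hrank, hfinp, q', hsha, hvq'⟩ := hbsd
  haveI := hfinp
  have hΩC : (W.realPeriodRat : ℂ) ≠ 0 := Complex.ofReal_ne_zero.mpr W.realPeriodRat_pos_holds.ne'
  have hT : 0 < W.torsionOrder := W.torsionOrder_pos_holds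
  have hc : 0 < W.tamagawaProduct := W.tamagawaProduct_pos'
  have hT0 : (W.torsionOrder : ℚ) ≠ 0 := by exact_mod_cast hT.ne'
  have hc0 : (W.tamagawaProduct : ℚ) ≠ 0 := by exact_mod_cast hc.ne'
  have hr0 : W.mordellWeilRank = 0 := hrank.trans hr
  have hReg : W.regulator = 1 := W.regulator_eq_one_of_rank_zero hr0
  have hL1 : W.entireLFunction 1 = (t : ℂ) * (W.realPeriodRat : ℂ) := by
    rw [← htq, div_mul_cancel₀ _ hΩC]
  have ht0 : t ≠ 0 := by
    rintro rfl
    apply hL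
    rw [hL1]
    simp
  have hq' : q' = t * (W.torsionOrder : ℚ) ^ 2 / (W.tamagawaProduct : ℚ) := by
    have h : shaAn W = ((t * (W.torsionOrder : ℚ) ^ 2 / (W.tamagawaProduct : ℚ) : ℚ) : ℂ) := by
      rw [shaAn_def, W.leadingLCoeff_eq_of_analyticRank_eq_zero hr, hL1, hReg]
      have hcC : ((W.tamagawaProduct : ℚ) : ℂ) ≠ 0 := by exact_mod_cast hc.ne'
      push_cast
      field_simp
    rw [hsha] at h
    exact_mod_cast h
  rw [hq', padicValRat.div (mul_ne_zero ht0 (pow_ne_zero 2 hT0)) hc0,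
    padicValRat.mul ht0 (pow_ne_zero 2 hT0), padicValRat.pow,
    padicValNat_card_addPrimaryComponent (A := W.sha) p, padicValRat.of_nat, padicValRat.of_nat] at hvq'
  simp only [WeierstrassCurve.shaOrder] at hval
  simp only [Nat.cast_ofNat] at hvq'
  have hk : k = 0 := by linarith
  -- `k = 0`: the integral main conjecture, and `μ = 0` from the certificate
  rw [hk, zpow_zero, map_one, one_mul] at hιg
  obtain ⟨n, hn⟩ := hcert Dm.f hf ϖ hϖeq
  rw [PowerSeries.coeff_C_mul, norm_mul, hϖnorm, one_mul] at hn
  exact mu_eq_zero_of_charIdeal_eq hγ D hX g hchar _ hιg ⟨n, hn⟩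

/-- **Class X9, analytic rank 0: `BSD(E,p)` is EQUIVALENT to Greenberg's `μ = 0` for `(E, p)`**,
granted the finite analytic certificate (a unit coefficient of `𝓛_MSD(E)`) and the PUBLISHED inputs
BCS 2025 Thm. 1.1.2 (a), Greenberg LNM 1716 Thm. 4.1, the period unit, modularity and GZK. The
typed residue of class X9 in rank 0 IS this conjecture instance, pair by pair.
[cite: GreenbergLNM1716, §1 Conj. 1.11 and Thm. 4.1 (p. 102)] [cite: BurungaleCastellaSkinner2025, Thm. 1.1.2 (a) (p. 2 of arXiv:2405.00270v2)]
[cite: CastellaEtAl2021, Thm. 5.1.4 and its proof (§5.1.3)] -/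
theorem X9.bsdp_iff_mu_eq_zero
    (hBCS : burungale_castella_skinner_charIdeal_eq_padicLFunction)
    (hGr : greenberg_charValue_rankZero) (h5 : realPeriodRat_eq_unit_mul_plusPeriod)
    (hmodP : nonempty_modularParametrizationData) (hmodL : hasEntireLFunction_rat)
    (hGZK : rank_eq_analyticRank_of_analyticRank_le_one)
    (hX9 : ClassX9 W p) (hr : W.analyticRank = 0)
    (hcert : ∀ [NeZero (W.conductorNorm ℤ)] (f : CuspForm (Gamma0 (W.conductorNorm ℤ)) 2),
        IsNewformOf W f → ∀ (ϖ : ℚ), (ϖ : ℝ) * W.realPeriodRat = plusPeriod f →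
      ∃ n : ℕ, ‖PowerSeries.coeff n
        (PowerSeries.C (ϖ : ℚ_[p]) * padicLFunction f (unitRoot W p : ℚ_[p]))‖ = 1) :
    BSDp W p ↔
      ∀ (κ : ZpExtension ℚ p) (γ : Field.absoluteGaloisGroup ℚ),
        κ.IsCyclotomic → κ.IsTopGenerator γ → IsCyclotomicVariable p γ →
      ∀ (D : W.SelmerDualData κ γ), D.mu = 0 :=
  ⟨fun hbsd => X9.mu_eq_zero_of_bsdp W p hBCS hGr h5 hmodP hmodL hGZK hX9 hr hbsd hcert,
    fun hμ => X9.bsdp_of_mu_eq_zero W p hBCS hGr h5 hmodP hmodL hGZK hX9 hr hμ hcert⟩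

end X9converse

/-! ## Appended (gen 5, same seat): route U2′ — the `p`-part of BSD PROPAGATES along mod-`p` congruences

Common generalisation of route U2 (`X9TrivialPartner.lean`: partner with trivial `p`-primary arithmetic)
and of the converse theorem above: **if `A/ℚ` has analytic rank `0`, good ordinary reduction at
`p ≥ 5`, `A[p]` irreducible, Miller's `BSD(A,p)` holds, and some coefficient of `𝓛_MSD(A)` is a
`p`-adic unit, then Mazur's main conjecture holds for `(A,p)` INTEGRALLY with `μ = 0`**
(`mazurMainConjecture_with_mu_zero_of_bsdp`: BCS (a) gives `ι g = p^k L_p(f_A,α)`; the exponent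
chain `padicValRat_lvalue_add_exponent_of_charIdeal_eq` and `BSD(A,p)` force `k = 0`; the certificate
gives `p ∤ g`). Greenberg–Vatsal 2000 Thm. (1.4) then carries the main conjecture with `μ = 0` along
any `Γ_ℚ`-isomorphism `A[p] ≅ E[p]` to an X9 pair `(E,p)` — whatever the image of `ρ̄_{E,p}` — and the
cell's glue yields `BSD(E,p)` in analytic rank `0`, and in rank `1` given the Schneider certificate
C3. So, at a good ordinary irreducible `p ≥ 5`, the `p`-part of BSD in analytic rank 0 propagates
along mod-`p` congruences to congruent curves of analytic rank `≤ 1`, at the cost of finite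
certificates (C1 Kraus–Oesterlé; `μ(𝓛_p(A)) = 0`; C3 in rank 1). Sources of `BSD(A,p)`: the tree's
named fact `bsdp_of_irreducible_of_conductor_lt` (Miller 2011 / Creutz–Miller 2012, `N_A < 5000`), or
any lane-certified rank-0 pair. No pair is closed by these theorems until its certificates are
lane-certified; class label unchanged; partner census `HOME/b2b-bsdres-x9/X9-U2-G5.md`. -/

/-! ### The partner side: `BSD(A,p)` in rank 0 + certificate ⟹ main conjecture with `μ = 0` -/

/-- **`BSD(A,p)` in analytic rank 0, plus one unit coefficient of `𝓛_MSD(A)`, give Mazur's main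
conjecture for `(A,p)` integrally with `μ = 0`.** `A` globally minimal, `p ≥ 5` good ordinary, `A[p]`
irreducible, `r_an(A) = 0`, Miller's `BSDp A p` (`hbsd`), and the certificate `hcert` (for every
newform `f_A` at level `N_A` and `ϖ_A·Ω_A = Ω⁺_{f_A}`, some coefficient of `ϖ_A·L_p(f_A, α)` is a
`p`-adic unit). PUBLISHED inputs: BCS 2025 Thm. 1.1.2 (a) (`hBCS`), Greenberg LNM 1716 Thm. 4.1
(`hGr`), the period unit (`h5`), modularity (`hmodL`, for `L(A,1) ≠ 0`), GZK (`hGZK`, finiteness of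
`Ш`). Conclusion: the `E₁`-hypothesis shape of Greenberg–Vatsal's Thm. (1.4)
(`thm14_mainConjecture_transfer_of_torsionIso`). Proof: BCS (a) gives `ι g = p^k·L_p(f_A,α)`;
`padicValRat_lvalue_add_exponent_of_charIdeal_eq` and `BSDp A p` give `k = 0`
(as in `X9.mu_eq_zero_of_bsdp`); then `ι(ϖ_A g) = ϖ_A·L_p` and the certificate is a unit coefficient
of `ϖ_A g`. [cite: CastellaEtAl2021, Thm. 5.1.4 and its proof (§5.1.3)] [cite: Miller2011LMS, Def. 1.1]
[cite: BurungaleCastellaSkinner2025, Thm. 1.1.2 (a) (p. 2 of arXiv:2405.00270v2)] -/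
theorem mazurMainConjecture_with_mu_zero_of_bsdp
    (hBCS : burungale_castella_skinner_charIdeal_eq_padicLFunction)
    (hGr : greenberg_charValue_rankZero) (h5 : realPeriodRat_eq_unit_mul_plusPeriod)
    (hmodL : hasEntireLFunction_rat) (hGZK : rank_eq_analyticRank_of_analyticRank_le_one)
    (A : WeierstrassCurve ℚ) [A.IsElliptic] [A.IsGloballyMinimal] (p : ℕ) [Fact p.Prime]
    (hp : 5 ≤ p) (hgood : A.HasGoodReductionAtPrime p) (hord : ¬ (p : ℤ) ∣ A.frobeniusTrace p)
    (hirr : A.HasIrreducibleModPGaloisRep p) (hrA : A.analyticRank = 0) (hbsd : BSDp A p)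
    (hcert : ∀ [NeZero (A.conductorNorm ℤ)] (fA : CuspForm (Gamma0 (A.conductorNorm ℤ)) 2),
        IsNewformOf A fA → ∀ (ϖ : ℚ), (ϖ : ℝ) * A.realPeriodRat = plusPeriod fA →
      ∃ n : ℕ, ‖PowerSeries.coeff n
        (PowerSeries.C (ϖ : ℚ_[p]) * padicLFunction fA (unitRoot A p : ℚ_[p]))‖ = 1) :
    ∀ (κ : ZpExtension ℚ p) (γ : Field.absoluteGaloisGroup ℚ),
        κ.IsCyclotomic → κ.IsTopGenerator γ → IsCyclotomicVariable p γ →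
      ∀ [NeZero (A.conductorNorm ℤ)] (fA : CuspForm (Gamma0 (A.conductorNorm ℤ)) 2),
        IsNewformOf A fA → ∀ (ϖ : ℚ), (ϖ : ℝ) * A.realPeriodRat = plusPeriod fA →
      ∀ (D : A.SelmerDualData κ γ), D.IsTorsion ∧
        ∃ g : IwasawaAlgebra p, D.charIdeal = Ideal.span {g} ∧
          GreenbergVatsal2000.HasUnitContent g ∧
          iwasawaToPowerSeries p g =
            PowerSeries.C (ϖ : ℚ_[p]) * padicLFunction fA (unitRoot A p : ℚ_[p]) := by
  intro κ γ hκ hγ hγ' _ fA hf ϖ hϖeq D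
  have hpP : p.Prime := Fact.out
  have hp2 : p ≠ 2 := by omega
  have hL : A.entireLFunction 1 ≠ 0 := (A.analyticRank_eq_zero_iff_holds (hmodL A)).1 hrA
  have hfin : Finite A.sha := (hGZK A (by omega)).2
  have hϖnorm : ‖(ϖ : ℚ_[p])‖ = 1 := norm_periodRatio_eq_one h5 A p hp hgood hirr fA hf ϖ hϖeq
  have hϖ0 : ϖ ≠ 0 := by
    rintro rfl
    simp at hϖnorm
  have hϖv : padicValRat p ϖ = 0 := by
    have h := Padic.norm_eq_zpow_neg_valuation (show ((ϖ : ℚ) : ℚ_[p]) ≠ 0 by exact_mod_cast hϖ0)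
    rw [hϖnorm, Padic.valuation_ratCast] at h
    have hp1 : (1 : ℝ) < p := by exact_mod_cast hpP.one_lt
    have h0 : (p : ℝ) ^ (0 : ℤ) = (p : ℝ) ^ (-padicValRat p ϖ) := by rw [zpow_zero]; exact h
    have := zpow_right_injective₀ (zero_lt_one.trans hp1) hp1.ne' h0
    omega
  -- BCS (a) and the chain with exponent `k`
  obtain ⟨hX, g, k, hchar, hιg⟩ := hBCS A p κ γ fA hp hgood hord hirr hκ hγ hγ' hf D
  obtain ⟨t, htq, hval⟩ := padicValRat_lvalue_add_exponent_of_charIdeal_eq A p hgood hord hL hfin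
    (hGr A p hp2 hgood hord) κ γ hκ hγ hγ' fA hf ϖ hϖeq hϖv D hX g k hchar hιg
  -- the same identity without `k`, from `BSDp A p`
  obtain ⟨hrank, hfinp, q', hsha, hvq'⟩ := hbsd
  haveI := hfinp
  have hΩC : (A.realPeriodRat : ℂ) ≠ 0 := Complex.ofReal_ne_zero.mpr A.realPeriodRat_pos_holds.ne'
  have hT : 0 < A.torsionOrder := A.torsionOrder_pos_holds
  have hc : 0 < A.tamagawaProduct := A.tamagawaProduct_pos'
  have hT0 : (A.torsionOrder : ℚ) ≠ 0 := by exact_mod_cast hT.ne'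
  have hc0 : (A.tamagawaProduct : ℚ) ≠ 0 := by exact_mod_cast hc.ne'
  have hr0 : A.mordellWeilRank = 0 := hrank.trans hrA
  have hReg : A.regulator = 1 := A.regulator_eq_one_of_rank_zero hr0
  have hL1 : A.entireLFunction 1 = (t : ℂ) * (A.realPeriodRat : ℂ) := by
    rw [← htq, div_mul_cancel₀ _ hΩC]
  have ht0 : t ≠ 0 := by
    rintro rfl
    apply hL
    rw [hL1]
    simp
  have hq' : q' = t * (A.torsionOrder : ℚ) ^ 2 / (A.tamagawaProduct : ℚ) := by
    have h : shaAn A = ((t * (A.torsionOrder : ℚ) ^ 2 / (A.tamagawaProduct : ℚ) : ℚ) : ℂ) := by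
      rw [shaAn_def, A.leadingLCoeff_eq_of_analyticRank_eq_zero hrA, hL1, hReg]
      have hcC : ((A.tamagawaProduct : ℚ) : ℂ) ≠ 0 := by exact_mod_cast hc.ne'
      push_cast
      field_simp
    rw [hsha] at h
    exact_mod_cast h
  rw [hq', padicValRat.div (mul_ne_zero ht0 (pow_ne_zero 2 hT0)) hc0,
    padicValRat.mul ht0 (pow_ne_zero 2 hT0), padicValRat.pow,
    padicValNat_card_addPrimaryComponent (A := A.sha) p, padicValRat.of_nat, padicValRat.of_nat] at hvq'
  simp only [WeierstrassCurve.shaOrder] at hval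
  simp only [Nat.cast_ofNat] at hvq'
  have hk : k = 0 := by linarith
  rw [hk, zpow_zero, map_one, one_mul] at hιg
  -- rescale by the unit `ϖ` and read off the unit content
  set c : ℤ_[p] := ⟨(ϖ : ℚ_[p]), hϖnorm.le⟩ with hc_def
  have hcu : IsUnit c := PadicInt.isUnit_iff.mpr hϖnorm
  have hι' : iwasawaToPowerSeries p (PowerSeries.C c * g) =
      PowerSeries.C (ϖ : ℚ_[p]) * padicLFunction fA (unitRoot A p : ℚ_[p]) := by
    rw [map_mul, hιg, PowerSeries.map_C]
    rfl
  refine ⟨hX, PowerSeries.C c * g, ?_, hasUnitContent_of_map_eq _ _ hι' (hcert fA hf ϖ hϖeq), hι'⟩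
  rw [hchar]
  exact (Ideal.span_singleton_mul_left_unit (hcu.map PowerSeries.C) g).symm

/-! ### Transfer to the X9 pair and `BSD(E,p)` -/

section BSDpPartner

variable (W A : WeierstrassCurve ℚ) [W.IsElliptic] [W.IsGloballyMinimal] [A.IsElliptic]
  [A.IsGloballyMinimal] (p : ℕ) [Fact p.Prime]

/-- **Route U2′, analytic rank 0: `BSD(E,p)` on class X9 from a congruent rank-0 partner `A` with
`BSD(A,p)` and `μ(𝓛_p(A)) = 0`.** PUBLISHED binders `hBCS`, `hGr`, `h5`, `hGV`, `hmodP`, `hmodL`,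
`hGZK`; `ClassX9 W p`, `W.analyticRank = 0`; the partner: good ordinary at `p`, `r_an(A) = 0`,
`BSDp A p` (`hbsdA`), certificate `hcertA`; C1 (`hC1`). The irreducibility of `A[p]` is that of `E[p]`
along C1. [cite: GreenbergVatsal2000, Thm. (1.4) (arXiv p. 5)] [cite: GreenbergLNM1716, Thm. 4.1 (p. 102)]
[cite: CastellaEtAl2021, Thm. 5.1.4 and its proof (the rank-0 descent)] -/
theorem X9.bsdp_of_bsdpPartner
    (hBCS : burungale_castella_skinner_charIdeal_eq_padicLFunction)
    (hGr : greenberg_charValue_rankZero) (h5 : realPeriodRat_eq_unit_mul_plusPeriod)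
    (hGV : GreenbergVatsal2000.thm14_mainConjecture_transfer_of_torsionIso)
    (hmodP : nonempty_modularParametrizationData) (hmodL : hasEntireLFunction_rat)
    (hGZK : rank_eq_analyticRank_of_analyticRank_le_one)
    (hX9 : ClassX9 W p) (hr : W.analyticRank = 0)
    (hgoodA : A.HasGoodReductionAtPrime p) (hordA : ¬ (p : ℤ) ∣ A.frobeniusTrace p)
    (hrA : A.analyticRank = 0) (hbsdA : BSDp A p)
    (hcertA : ∀ [NeZero (A.conductorNorm ℤ)] (fA : CuspForm (Gamma0 (A.conductorNorm ℤ)) 2),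
        IsNewformOf A fA → ∀ (ϖ : ℚ), (ϖ : ℝ) * A.realPeriodRat = plusPeriod fA →
      ∃ n : ℕ, ‖PowerSeries.coeff n
        (PowerSeries.C (ϖ : ℚ_[p]) * padicLFunction fA (unitRoot A p : ℚ_[p]))‖ = 1)
    (hC1 : ∃ e : geomTorsion A (p : ℤ) ≃+ geomTorsion W (p : ℤ),
      ∀ (σ : Field.absoluteGaloisGroup ℚ) (P : geomTorsion A (p : ℤ)), e (σ • P) = σ • e P) :
    BSDp W p := by
  obtain ⟨-, ⟨hgood, hord⟩, hp, hirr, -, -⟩ := id hX9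
  have hp2 : p ≠ 2 := by omega
  obtain ⟨e, he⟩ := hC1
  have hirrA : A.HasIrreducibleModPGaloisRep p :=
    hasIrreducibleModPGaloisRep_of_torsionIso_symm e he hirr
  have hL1 : W.entireLFunction 1 ≠ 0 := (W.analyticRank_eq_zero_iff_holds (hmodL W)).1 hr
  exact bsdp_of_pPartRankZero W p hmodL hGZK hr
    (GreenbergVatsal2000.pPartRankZero_of_thm14 A W p hGV hmodP hGZK hp2 hgoodA hordA hgood hord
      ⟨e, he⟩ hirrA
      (mazurMainConjecture_with_mu_zero_of_bsdp hBCS hGr h5 hmodL hGZK A p hp hgoodA hordA hirrA hrA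
        hbsdA hcertA)
      hL1 (hGr W p hp2 hgood hord))

/-- **Route U2′, analytic rank 1** (+ the Schneider certificate C3), through the cell's rank-one
engine `Wuthrich2014.missingPPartAt_of_mainConjecture_of_rank_one`.
[cite: GreenbergVatsal2000, Thm. (1.4) (arXiv p. 5)] [cite: PerrinRiou1987, §1.4 Cor. 1.8]
[cite: BalakrishnanMullerStein2015, Thm. 1.7] -/
theorem X9.bsdp_of_bsdpPartner_of_analyticRank_eq_one
    (hBCS : burungale_castella_skinner_charIdeal_eq_padicLFunction)
    (hGr : greenberg_charValue_rankZero) (h5 : realPeriodRat_eq_unit_mul_plusPeriod)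
    (hGV : GreenbergVatsal2000.thm14_mainConjecture_transfer_of_torsionIso)
    (hS : Schneider1985_order_charGenerator) (hPR : perrinRiou_rankOne_leadingTerms)
    (hmodP : nonempty_modularParametrizationData) (hmodL : hasEntireLFunction_rat)
    (hGZK : rank_eq_analyticRank_of_analyticRank_le_one)
    (hX9 : ClassX9 W p) (hr : W.analyticRank = 1)
    (hgoodA : A.HasGoodReductionAtPrime p) (hordA : ¬ (p : ℤ) ∣ A.frobeniusTrace p)
    (hrA : A.analyticRank = 0) (hbsdA : BSDp A p)
    (hcertA : ∀ [NeZero (A.conductorNorm ℤ)] (fA : CuspForm (Gamma0 (A.conductorNorm ℤ)) 2),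
        IsNewformOf A fA → ∀ (ϖ : ℚ), (ϖ : ℝ) * A.realPeriodRat = plusPeriod fA →
      ∃ n : ℕ, ‖PowerSeries.coeff n
        (PowerSeries.C (ϖ : ℚ_[p]) * padicLFunction fA (unitRoot A p : ℚ_[p]))‖ = 1)
    (hC1 : ∃ e : geomTorsion A (p : ℤ) ≃+ geomTorsion W (p : ℤ),
      ∀ (σ : Field.absoluteGaloisGroup ℚ) (P : geomTorsion A (p : ℤ)), e (σ • P) = σ • e P)
    (hC3 : ∀ Dh : PAdicHeightData W p, Dh.IsCanonical → SchneiderConjecture Dh) :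
    BSDp W p := by
  obtain ⟨-, ⟨hgood, hord⟩, hp, hirr, -, -⟩ := id hX9
  have hp2 : p ≠ 2 := by omega
  obtain ⟨e, he⟩ := hC1
  have hirrA : A.HasIrreducibleModPGaloisRep p :=
    hasIrreducibleModPGaloisRep_of_torsionIso_symm e he hirr
  refine Typed.bsdp_of_missingPPartAt W p hGZK (by omega)
    (Wuthrich2014.missingPPartAt_of_mainConjecture_of_rank_one hS hPR hmodP hGZK W p hp hgood
      hord hr hC3 ?_)
  exact GreenbergVatsal2000.mazurMainConjecture_of_thm14 A W p hGV hp2 hgoodA hordA hgood hord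
    ⟨e, he⟩ hirrA
    (mazurMainConjecture_with_mu_zero_of_bsdp hBCS hGr h5 hmodL hGZK A p hp hgoodA hordA hirrA hrA
      hbsdA hcertA)

/-- **Route U2′ in the canonical cell shape, both ranks** (C3 only in rank 1).
[cite: GreenbergVatsal2000, Thm. (1.4) (arXiv p. 5)] [cite: GreenbergLNM1716, Thm. 4.1 (p. 102)]
[cite: PerrinRiou1987, §1.4 Cor. 1.8] -/
theorem X9.bsdp_of_bsdpPartner_of_analyticRank_le_one
    (hBCS : burungale_castella_skinner_charIdeal_eq_padicLFunction)
    (hGr : greenberg_charValue_rankZero) (h5 : realPeriodRat_eq_unit_mul_plusPeriod)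
    (hGV : GreenbergVatsal2000.thm14_mainConjecture_transfer_of_torsionIso)
    (hS : Schneider1985_order_charGenerator) (hPR : perrinRiou_rankOne_leadingTerms)
    (hmodP : nonempty_modularParametrizationData) (hmodL : hasEntireLFunction_rat)
    (hGZK : rank_eq_analyticRank_of_analyticRank_le_one)
    (hran : W.analyticRank ≤ 1) (hX9 : ClassX9 W p)
    (hgoodA : A.HasGoodReductionAtPrime p) (hordA : ¬ (p : ℤ) ∣ A.frobeniusTrace p)
    (hrA : A.analyticRank = 0) (hbsdA : BSDp A p)
    (hcertA : ∀ [NeZero (A.conductorNorm ℤ)] (fA : CuspForm (Gamma0 (A.conductorNorm ℤ)) 2),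
        IsNewformOf A fA → ∀ (ϖ : ℚ), (ϖ : ℝ) * A.realPeriodRat = plusPeriod fA →
      ∃ n : ℕ, ‖PowerSeries.coeff n
        (PowerSeries.C (ϖ : ℚ_[p]) * padicLFunction fA (unitRoot A p : ℚ_[p]))‖ = 1)
    (hC1 : ∃ e : geomTorsion A (p : ℤ) ≃+ geomTorsion W (p : ℤ),
      ∀ (σ : Field.absoluteGaloisGroup ℚ) (P : geomTorsion A (p : ℤ)), e (σ • P) = σ • e P)
    (hC3 : W.analyticRank = 1 → ∀ Dh : PAdicHeightData W p, Dh.IsCanonical → SchneiderConjecture Dh) :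
    BSDp W p := by
  rcases Nat.le_one_iff_eq_zero_or_eq_one.mp hran with hr | hr
  · exact X9.bsdp_of_bsdpPartner W A p hBCS hGr h5 hGV hmodP hmodL hGZK hX9 hr hgoodA hordA hrA hbsdA
      hcertA hC1
  · exact X9.bsdp_of_bsdpPartner_of_analyticRank_eq_one W A p hBCS hGr h5 hGV hS hPR hmodP hmodL
      hGZK hX9 hr hgoodA hordA hrA hbsdA hcertA hC1 (hC3 hr)

/-- **The typed X9 output at a certified pair of route U2′.** [cite: Miller2011LMS, Def. 1.1]
[cite: GreenbergVatsal2000, Thm. (1.4) (arXiv p. 5)] -/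
theorem X9.missingInputAt_of_bsdpPartner
    (hBCS : burungale_castella_skinner_charIdeal_eq_padicLFunction)
    (hGr : greenberg_charValue_rankZero) (h5 : realPeriodRat_eq_unit_mul_plusPeriod)
    (hGV : GreenbergVatsal2000.thm14_mainConjecture_transfer_of_torsionIso)
    (hS : Schneider1985_order_charGenerator) (hPR : perrinRiou_rankOne_leadingTerms)
    (hmodP : nonempty_modularParametrizationData) (hmodL : hasEntireLFunction_rat)
    (hGZK : rank_eq_analyticRank_of_analyticRank_le_one)
    (hran : W.analyticRank ≤ 1) (hX9 : ClassX9 W p)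
    (hgoodA : A.HasGoodReductionAtPrime p) (hordA : ¬ (p : ℤ) ∣ A.frobeniusTrace p)
    (hrA : A.analyticRank = 0) (hbsdA : BSDp A p)
    (hcertA : ∀ [NeZero (A.conductorNorm ℤ)] (fA : CuspForm (Gamma0 (A.conductorNorm ℤ)) 2),
        IsNewformOf A fA → ∀ (ϖ : ℚ), (ϖ : ℝ) * A.realPeriodRat = plusPeriod fA →
      ∃ n : ℕ, ‖PowerSeries.coeff n
        (PowerSeries.C (ϖ : ℚ_[p]) * padicLFunction fA (unitRoot A p : ℚ_[p]))‖ = 1)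
    (hC1 : ∃ e : geomTorsion A (p : ℤ) ≃+ geomTorsion W (p : ℤ),
      ∀ (σ : Field.absoluteGaloisGroup ℚ) (P : geomTorsion A (p : ℤ)), e (σ • P) = σ • e P)
    (hC3 : W.analyticRank = 1 → ∀ Dh : PAdicHeightData W p, Dh.IsCanonical → SchneiderConjecture Dh) :
    Typed.X9.MissingInputAt W p := by
  haveI : Finite W.sha := (hGZK W hran).2
  exact Typed.X9.missingInputAt_of_bsdp W p
    (X9.bsdp_of_bsdpPartner_of_analyticRank_le_one W A p hBCS hGr h5 hGV hS hPR hmodP hmodL hGZK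
      hran hX9 hgoodA hordA hrA hbsdA hcertA hC1 hC3)

/-- **Route U2′ with C1 as the Kraus–Oesterlé congruence list, both ranks.**
[cite: KrausOesterle1992, Prop. 4] [cite: GreenbergVatsal2000, Thm. (1.4) (arXiv p. 5)] -/
theorem X9.bsdp_of_bsdpPartner_of_congruences_of_analyticRank_le_one
    (hKO : KrausOesterle1992.prop4_torsionIso_of_congruences)
    (hBCS : burungale_castella_skinner_charIdeal_eq_padicLFunction)
    (hGr : greenberg_charValue_rankZero) (h5 : realPeriodRat_eq_unit_mul_plusPeriod)
    (hGV : GreenbergVatsal2000.thm14_mainConjecture_transfer_of_torsionIso)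
    (hS : Schneider1985_order_charGenerator) (hPR : perrinRiou_rankOne_leadingTerms)
    (hmodP : nonempty_modularParametrizationData) (hmodL : hasEntireLFunction_rat)
    (hGZK : rank_eq_analyticRank_of_analyticRank_le_one)
    (hran : W.analyticRank ≤ 1) (hX9 : ClassX9 W p)
    (hgoodA : A.HasGoodReductionAtPrime p) (hordA : ¬ (p : ℤ) ∣ A.frobeniusTrace p)
    (hrA : A.analyticRank = 0) (hbsdA : BSDp A p)
    (hcertA : ∀ [NeZero (A.conductorNorm ℤ)] (fA : CuspForm (Gamma0 (A.conductorNorm ℤ)) 2),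
        IsNewformOf A fA → ∀ (ϖ : ℚ), (ϖ : ℝ) * A.realPeriodRat = plusPeriod fA →
      ∃ n : ℕ, ‖PowerSeries.coeff n
        (PowerSeries.C (ϖ : ℚ_[p]) * padicLFunction fA (unitRoot A p : ℚ_[p]))‖ = 1)
    (hcong : ∀ (ℓ : ℕ) [Fact ℓ.Prime],
      6 * ℓ < KrausOesterle1992.gammaZeroIndex (KrausOesterle1992.modulus W A) →
      (padicValNat ℓ (W.conductorNorm ℤ * A.conductorNorm ℤ) = 0 →
          (p : ℤ) ∣ W.frobeniusTrace ℓ - A.frobeniusTrace ℓ) ∧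
        (padicValNat ℓ (W.conductorNorm ℤ * A.conductorNorm ℤ) = 1 →
          (p : ℤ) ∣ W.frobeniusTrace ℓ * A.frobeniusTrace ℓ - (ℓ + 1)))
    (hC3 : W.analyticRank = 1 → ∀ Dh : PAdicHeightData W p, Dh.IsCanonical → SchneiderConjecture Dh) :
    BSDp W p := by
  obtain ⟨-, -, -, hirr, -, -⟩ := id hX9
  exact X9.bsdp_of_bsdpPartner_of_analyticRank_le_one W A p hBCS hGr h5 hGV hS hPR hmodP hmodL hGZK
    hran hX9 hgoodA hordA hrA hbsdA hcertA
    (KrausOesterle1992.torsionIso_of_congruences hKO W A p hirr hcong) hC3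

/-- **Route U2′ with a partner of conductor `< 5000`: every binder a PUBLISHED fact or a FINITE
certificate.** `BSD(A,p)` from Miller / Creutz–Miller (`hMiller`, `bsdp_of_irreducible_of_conductor_lt`;
`A[p]` irreducible along C1); C1 as the Kraus–Oesterlé list. FINITE certificates: `r_an(A) = 0`
(`hrA`), `N_A < 5000` (`hNA`), `hcertA` (a unit coefficient of `𝓛_MSD(A)` — the constant one when `A`
is non-anomalous with `p ∤ ∏c_ℓ(A)·#Ш_an(A)`, otherwise a modular-symbol computation), `hcong`, and C3
in rank 1. [cite: Miller2011LMS, Thm. 1.2] [cite: CreutzMiller2012, Thm. 1.1] [cite: KrausOesterle1992, Prop. 4]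
[cite: GreenbergVatsal2000, Thm. (1.4) (arXiv p. 5)] -/
theorem X9.bsdp_of_bsdpPartner_of_conductor_lt_of_analyticRank_le_one
    (hKO : KrausOesterle1992.prop4_torsionIso_of_congruences)
    (hMiller : bsdp_of_irreducible_of_conductor_lt)
    (hBCS : burungale_castella_skinner_charIdeal_eq_padicLFunction)
    (hGr : greenberg_charValue_rankZero) (h5 : realPeriodRat_eq_unit_mul_plusPeriod)
    (hGV : GreenbergVatsal2000.thm14_mainConjecture_transfer_of_torsionIso)
    (hS : Schneider1985_order_charGenerator) (hPR : perrinRiou_rankOne_leadingTerms)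
    (hmodP : nonempty_modularParametrizationData) (hmodL : hasEntireLFunction_rat)
    (hGZK : rank_eq_analyticRank_of_analyticRank_le_one)
    (hran : W.analyticRank ≤ 1) (hX9 : ClassX9 W p)
    (hgoodA : A.HasGoodReductionAtPrime p) (hordA : ¬ (p : ℤ) ∣ A.frobeniusTrace p)
    (hrA : A.analyticRank = 0) (hNA : A.conductorNorm ℤ < 5000)
    (hcertA : ∀ [NeZero (A.conductorNorm ℤ)] (fA : CuspForm (Gamma0 (A.conductorNorm ℤ)) 2),
        IsNewformOf A fA → ∀ (ϖ : ℚ), (ϖ : ℝ) * A.realPeriodRat = plusPeriod fA →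
      ∃ n : ℕ, ‖PowerSeries.coeff n
        (PowerSeries.C (ϖ : ℚ_[p]) * padicLFunction fA (unitRoot A p : ℚ_[p]))‖ = 1)
    (hcong : ∀ (ℓ : ℕ) [Fact ℓ.Prime],
      6 * ℓ < KrausOesterle1992.gammaZeroIndex (KrausOesterle1992.modulus W A) →
      (padicValNat ℓ (W.conductorNorm ℤ * A.conductorNorm ℤ) = 0 →
          (p : ℤ) ∣ W.frobeniusTrace ℓ - A.frobeniusTrace ℓ) ∧
        (padicValNat ℓ (W.conductorNorm ℤ * A.conductorNorm ℤ) = 1 →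
          (p : ℤ) ∣ W.frobeniusTrace ℓ * A.frobeniusTrace ℓ - (ℓ + 1)))
    (hC3 : W.analyticRank = 1 → ∀ Dh : PAdicHeightData W p, Dh.IsCanonical → SchneiderConjecture Dh) :
    BSDp W p := by
  obtain ⟨-, -, -, hirr, -, -⟩ := id hX9
  obtain ⟨e, he⟩ := KrausOesterle1992.torsionIso_of_congruences hKO W A p hirr hcong
  have hirrA : A.HasIrreducibleModPGaloisRep p :=
    hasIrreducibleModPGaloisRep_of_torsionIso_symm e he hirr
  exact X9.bsdp_of_bsdpPartner_of_analyticRank_le_one W A p hBCS hGr h5 hGV hS hPR hmodP hmodL hGZK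
    hran hX9 hgoodA hordA hrA (hMiller A (by omega) hNA p Fact.out hirrA) hcertA ⟨e, he⟩ hC3

end BSDpPartner

end Literature.NumberTheory.EllipticCurves.Rank1Residual

end
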